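import Literature.Claims.NS.Atarka2026
import HarnessLib

/-!
# Solo refutation companion (D-0090 NS-CLAIMS, C128): Atarka, HAL hal-05563207 v1 (2026) — Steps 8 and 11
# at the scalar grain of their printed proofs

Cell `ns-claims`. Kit by **ns-claims-typist-12 g2** (`claims/Atarka2026/killkit-scalar-typist12.lean`, sha16
7d5f58dfff9c14ce), adopted UNCHANGED (this docblock apart) by the refuter of record ns-claims-refuter-7 g0 as the
sibling of `SoloRefuteAtarka2026.lean` (Step 1 kill, the locator of record); imports the LANDED skeleton
`Literature.Claims.NS.Atarka2026` (p488843 @ 8591c03c5372).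

Contents: `not_Thm91Abs`, `not_Thm91Abs'` (Thm 9.1 proof, PDF p.6 l.71–78, readings R1/R2) and `not_Thm71Abs`,
`not_Thm71Abs'` (Thm 7.1 proof (20)–(24), PDF p.6 l.1–33, readings R1/R2). All four are statements about real
numbers / real functions; std axioms. They kill the printed INFERENCES at the sentence grain; the NS-grain Steps
`Thm71`, `Thm91`/`Thm91w` (quantified over classical no-slip solutions on a bounded Ω) are not decided by them.

WHAT THIS IS NOT: not a statement about the Navier–Stokes problem itself; not about any author beyond the typed
locator.
-/

noncomputable section

-- lint debt (cell convention, SoloRefute files): the Theorems namespace repeats `NavierStokesRegularity`.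
set_option linter.dupNamespace false

namespace Summit.NavierStokesRegularity.NavierStokesRegularity.Theorems.Atarka2026

open Literature.Claims.NS.Atarka2026


/-- **Kill of Step 11 at the grain of its printed proof, reading R1** — Thm 9.1 proof, PDF p.6 l.71–78
(«Ainsi, pour t suffisamment grand, ‖T(u)u‖ devient arbitrairement petit. De même, ‖Δu‖ est contrôlé. Il
existe donc T* tel que E(T*) ≤ δ₀»): with `ν = λ₁ = C_L = 1`, `δ₀ = 1/4`, `a₀ = 1`, the functions
`a(t) = e^{−t}` ((26) with equality), `h₁ = h₂ = d ≡ 1`, `e(t) = √(e^{−t})` ((27) with equality) satisfy every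
printed input, yet `E(T) = e(T)²/2 + 1/2 > 1/4` for all `T`. [claim: Atarka2026, status: disputed]
WHAT THIS IS NOT: not a claim about NS regularity or blow-up; not a claim about any author beyond the typed
locator. -/
theorem not_Thm91Abs : ¬ Literature.Claims.NS.Atarka2026.Thm91Abs := by
  intro h
  obtain ⟨T, hT, hE⟩ := h 1 1 1 (1/4) 1 one_pos one_pos one_pos (by norm_num) zero_le_one
    (fun t => Real.exp (-t)) (fun t => Real.sqrt (Real.exp (-t))) (fun _ => 1) (fun _ => 1) (fun _ => 1)
    (fun t _ => ⟨(Real.exp_pos _).le, Real.sqrt_nonneg _, zero_le_one, zero_le_one, zero_le_one⟩)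
    (fun t _ => by
      rw [one_pow, one_mul, ← Real.exp_nat_mul]
      exact le_of_eq (by ring_nf))
    (fun t _ => by simp)
    (fun t _ => le_rfl)
  have : 0 ≤ (Real.sqrt (Real.exp (-T))) ^ 2 / 2 := by positivity
  norm_num at hE
  linarith

/-- **Kill of Step 11, reading R2 (charitable: ‖u‖_{H¹}, ‖u‖_{H²} bounded)** — same witness, bound `M = 1`.
[claim: Atarka2026, status: disputed] -/
theorem not_Thm91Abs' : ¬ Literature.Claims.NS.Atarka2026.Thm91Abs' := by
  intro h
  obtain ⟨T, hT, hE⟩ := h 1 1 1 (1/4) 1 one_pos one_pos one_pos (by norm_num) zero_le_one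
    (fun t => Real.exp (-t)) (fun t => Real.sqrt (Real.exp (-t))) (fun _ => 1) (fun _ => 1) (fun _ => 1)
    (fun t _ => ⟨(Real.exp_pos _).le, Real.sqrt_nonneg _, zero_le_one, zero_le_one, zero_le_one⟩)
    ⟨1, fun t _ => ⟨le_rfl, le_rfl⟩⟩
    (fun t _ => by
      rw [one_pow, one_mul, ← Real.exp_nat_mul]
      exact le_of_eq (by ring_nf))
    (fun t _ => by simp)
    (fun t _ => le_rfl)
  have : 0 ≤ (Real.sqrt (Real.exp (-T))) ^ 2 / 2 := by positivity
  norm_num at hE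
  linarith

/-- **Kill of Step 8 at the grain of its printed proof, reading R1** — Thm 7.1 proof (20)–(24), PDF p.6
l.1–33 («En utilisant l'inégalité de Poincaré … et les bornes sur les normes, on obtient (24)»): with all
constants `1`, given the `C` of (24) take `e = e₁ = d = g = 1`, `h₂ = d₁ = l₄ = 0`, `h₁ = H = max C 0 + 2` and
`D = H − 1` (= the right side of (20)–(23)); (20)–(23), Poincaré and (18) hold, (24) would give
`H − 1 ≤ C − 1/2`. [claim: Atarka2026, status: disputed] -/
theorem not_Thm71Abs : ¬ Literature.Claims.NS.Atarka2026.Thm71Abs := by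
  intro h
  obtain ⟨C, hC⟩ := h 1 1 1 1 1 1 1 one_pos one_pos one_pos one_pos one_pos one_pos one_pos
  set H : ℝ := max C 0 + 2 with hH
  have hH0 : 0 ≤ H := by have := le_max_right C 0; linarith
  have hHC : C + 2 ≤ H := by have := le_max_left C 0; linarith
  have key := hC 1 1 H 0 1 0 1 0 (H - 1) zero_le_one zero_le_one hH0 le_rfl zero_le_one le_rfl
    zero_le_one le_rfl (by ring_nf; linarith) (by norm_num) (by norm_num)
  norm_num at key
  linarith

/-- **Kill of Step 8, reading R2 (charitable: norms tied by `h₁, h₂ ≤ κd`, `l₄ ≤ κd²`, `d₁ ≤ d + g`,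
`e ≤ κd²`)** — all constants and `κ` equal to `1`; given `C`, take `s = max C 0 + 1`, `e = e₁ = 0`,
`h₁ = h₂ = d = g = s`, `l₄ = s²`, `d₁ = 2s`, `D = s⁴ + 3s³ − s²` (= the right side of (20)–(23)): the term
`‖u‖_{H¹}‖∇u‖²_{L⁴}‖Δu‖ ~ E²` of (22) defeats `C E^{3/2}` (`E = s²/2`). [claim: Atarka2026, status: disputed] -/
theorem not_Thm71Abs' : ¬ Literature.Claims.NS.Atarka2026.Thm71Abs' := by
  intro h
  obtain ⟨C, hC⟩ := h 1 1 1 1 1 1 1 1 one_pos one_pos one_pos one_pos one_pos one_pos one_pos one_pos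
  set s : ℝ := max C 0 + 1 with hs
  have hs1 : 1 ≤ s := by have := le_max_right C 0; linarith
  have hs0 : 0 ≤ s := by linarith
  have hsC : C ≤ s - 1 := by have := le_max_left C 0; linarith
  have key := hC 0 0 s s s (2 * s) s (s ^ 2) (s ^ 4 + 3 * s ^ 3 - s ^ 2) le_rfl le_rfl hs0 hs0 hs0
    (by linarith) hs0 (by positivity) (by linarith) (by linarith) (by nlinarith) (by linarith)
    (by positivity) (by ring_nf; linarith) (by nlinarith) (by nlinarith)
  -- bound the right-hand side: `C (s²/2)^{3/2} − s²/4 ≤ (s−1)s³ − s²/4`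
  have hpow : (0 ^ 2 / 2 + (1:ℝ) ^ 2 * s ^ 2 / 2) ^ ((3:ℝ) / 2) ≤ s ^ 3 := by
    have h1 : (0 ^ 2 / 2 + (1:ℝ) ^ 2 * s ^ 2 / 2) ≤ s ^ 2 := by nlinarith
    have h2 : (0:ℝ) ≤ 0 ^ 2 / 2 + (1:ℝ) ^ 2 * s ^ 2 / 2 := by positivity
    have h3 : (s ^ 2 : ℝ) ^ ((3:ℝ) / 2) = s ^ 3 := by
      rw [← Real.rpow_natCast s 2, ← Real.rpow_mul hs0, show ((2:ℕ):ℝ) * ((3:ℝ) / 2) = (3:ℕ) by norm_num,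
        Real.rpow_natCast]
    calc (0 ^ 2 / 2 + (1:ℝ) ^ 2 * s ^ 2 / 2) ^ ((3:ℝ) / 2) ≤ (s ^ 2) ^ ((3:ℝ) / 2) :=
          Real.rpow_le_rpow h2 h1 (by norm_num)
      _ = s ^ 3 := h3
  have hnn : (0:ℝ) ≤ (0 ^ 2 / 2 + (1:ℝ) ^ 2 * s ^ 2 / 2) ^ ((3:ℝ) / 2) := by positivity
  have hs3 : (0:ℝ) ≤ (s - 1) * s ^ 3 := mul_nonneg (by linarith) (by positivity)
  have hCx : C * (0 ^ 2 / 2 + (1:ℝ) ^ 2 * s ^ 2 / 2) ^ ((3:ℝ) / 2) ≤ (s - 1) * s ^ 3 := by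
    rcases le_or_gt 0 C with hc | hc
    · calc C * _ ≤ C * s ^ 3 := mul_le_mul_of_nonneg_left hpow hc
        _ ≤ (s - 1) * s ^ 3 := mul_le_mul_of_nonneg_right hsC (by positivity)
    · have : C * (0 ^ 2 / 2 + (1:ℝ) ^ 2 * s ^ 2 / 2) ^ ((3:ℝ) / 2) ≤ 0 :=
        mul_nonpos_of_nonpos_of_nonneg hc.le hnn
      linarith
  have hlin : (1:ℝ) * 1 / 2 * (0 ^ 2 / 2 + (1:ℝ) ^ 2 * s ^ 2 / 2) = s ^ 2 / 4 := by ring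
  rw [hlin] at key
  have h3 : s ^ 4 + 3 * s ^ 3 - s ^ 2 ≤ (s - 1) * s ^ 3 - s ^ 2 / 4 := by linarith
  nlinarith [h3, hs1, sq_nonneg s, mul_nonneg hs0 hs0]


end Summit.NavierStokesRegularity.NavierStokesRegularity.Theorems.Atarka2026
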